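import Literature.Probability.LatticeModels.PlusDomainCorr
import HarnessLib

/-!
# Comparison theorems for the `+` domain correlations `plusDomainCorr`

Topic `Probability/LatticeModels`. Theorem-only companion of `PlusDomainCorr.lean` (no definitions, no
named facts). For the nearest-neighbour Ising model with `+` boundary condition, `β, h ≥ 0`:

* `isingCorr_plus_le_of_subset_right`, `isingCorr_plus_anti_volume` — **volume antitonicity of `+`
  correlations for every set of sites `A`** on any locally finite graph:
  `⟨σ_A⟩⁺_{Λ₂;β,h} ≤ ⟨σ_A⟩⁺_{Λ₁;β,h}` for `Λ₁ ⊆ Λ₂` (Friedli–Velenik 2017, Exercise 3.12, p. 112 /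
  Lemma 3.22, p. 111). The tree theorem `isingCorr_plus_le_of_subset` (`GKSInequalities.lean`) asks
  `A ⊆ Λ₁`; its proof (the `+` state of `Λ₁` is the `+` state of `Λ₂` conditioned on `σ ≡ +1` on
  `Λ₂ ∖ Λ₁`, and freezing spins to `+1` raises correlations, `gksExpect_le_frozen`) only uses
  `A ⊆ Λ₂`, and the spins of `A ∖ Λ₂` are frozen to `+1` on both sides (`isingCorr_plus_eq_filter`);
* consequently the domain monotonicity and bulk bounds of `PlusDomainCorr.lean` hold for **all**
  sites `y` (not only `δyᵢ ∈ Ω`): `plusDomainCorr_antitone_set`, `plusExpect_le_plusDomainCorr`,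
  `criticalCorr_le_plusDomainCorr_apply`;
* **lattice-translation covariance** `plusDomainCorr_vadd`:
  `⟨∏ᵢ σ_{yᵢ + w}⟩⁺_{(δw + Ω)_δ;β,0} = ⟨∏ᵢ σ_{yᵢ}⟩⁺_{Ω_δ;β,0}` for `w ∈ ℤ^d` (Friedli–Velenik 2017,
  Thm. 3.17 (2) and its proof, p. 113: `⟨f ∘ θ_w⟩⁺_{Λ+w} = ⟨f⟩⁺_Λ`, with independence of the limit
  from the exhausting sequence), by the squeeze of `plusCorr_shift`: the finite-volume covariance
  `isingExpect_plus_shift` (`PlusStateFKG.lean`) and the sandwich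
  `(Ω_δ ∩ B(L - ‖w‖_∞)) + w ⊆ (δw + Ω)_δ ∩ B(L) ⊆ (Ω_δ ∩ B(L + ‖w‖_∞)) + w`.

## References

* S. Friedli, Y. Velenik, *Statistical Mechanics of Lattice Systems* (CUP 2017), Lemma 3.22 (p. 111),
  Exercise 3.12 (p. 112), Thm. 3.17 (p. 106) and its proof (p. 113).
-/

noncomputable section

open scoped Classical Pointwise
open MeasureTheory Filter Topology Finset

namespace Literature.Probability.LatticeModels

/-! ### Volume antitonicity of `+` correlations for arbitrary sets of sites -/

section General

variable {V : Type*} [DecidableEq V] (G : SimpleGraph V) [G.LocallyFinite]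

/-- **Antitonicity of `+` correlations in the volume, for `A ⊆ Λ₂`** (Griffiths 1967; Friedli–Velenik
2017, Exercise 3.12, p. 112 / Lemma 3.22, p. 111), on any locally finite graph and for `β, h ≥ 0`:
`⟨σ_A⟩⁺_{Λ₂;β,h} ≤ ⟨σ_A⟩⁺_{Λ₁;β,h}` for `Λ₁ ⊆ Λ₂` — the proof of the tree's
`isingCorr_plus_le_of_subset` verbatim (the `+` state of `Λ₁` is the `+` state of `Λ₂` conditioned on
`σ ≡ +1` on `Λ₂ ∖ Λ₁`, proof of Lemma 3.22, and `gksExpect_le_frozen`), which never used `A ⊆ Λ₁`. [cite: FriedliVelenik2017, Exercise 3.12, p. 112] -/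
theorem isingCorr_plus_le_of_subset_right {Λ₁ Λ₂ A : Finset V} {β h : ℝ} (hβ : 0 ≤ β) (hh : 0 ≤ h)
    (hA : A ⊆ Λ₂) (h12 : Λ₁ ⊆ Λ₂) :
    isingCorr G Λ₂ β h .plus A ≤ isingCorr G Λ₁ β h .plus A := by
  set D : Finset ↥Λ₂ := univ.filter fun z : ↥Λ₂ => (z : V) ∉ Λ₁ with hD
  set κ : ℝ := Real.exp (β * #(edgesTouching G Λ₂ \ edgesTouching G Λ₁) + β * h * #(Λ₂ \ Λ₁)) with hκ
  have hκpos : 0 < κ := Real.exp_pos _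
  -- the frozen predicate in three guises
  have hfilt : (univ.filter fun ω : SpinConfig ↥Λ₂ => ∀ x ∈ D, ω x = 1) =
      univ.filter fun ω : SpinConfig ↥Λ₂ => ∀ x, x ∉ Set.range (volIncl h12) → ω x = 1 := by
    refine Finset.filter_congr fun ω _ => ?_
    have hrange : ∀ x : ↥Λ₂, x ∉ Set.range (volIncl h12) ↔ (x : V) ∉ Λ₁ := by
      intro x
      constructor
      · intro hx hx1
        exact hx ⟨⟨x, hx1⟩, rfl⟩
      · rintro hx ⟨z, rfl⟩
        exact hx z.2
    simp only [hD, Finset.mem_filter, Finset.mem_univ, true_and, hrange]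
  have hmem : ∀ ω : SpinConfig ↥Λ₂, ω ∈ (univ.filter fun ω : SpinConfig ↥Λ₂ => ∀ x ∈ D, ω x = 1) →
      ∀ z : ↥Λ₂, (z : V) ∉ Λ₁ → ω z = 1 := by
    intro ω hω z hz
    rw [Finset.mem_filter] at hω
    exact hω.2 z (by simp [hD, hz])
  -- weights and observables on frozen configurations
  have hw : ∀ ω : SpinConfig ↥Λ₂, (∀ z : ↥Λ₂, (z : V) ∉ Λ₁ → ω z = 1) →
      gksWeight (isingIdx G Λ₂) (gksCoupling G Λ₂ β h .plus) (isingSupp Λ₂) ω =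
        κ * isingWeight G Λ₁ β h .plus (ω ∘ volIncl h12) := by
    intro ω hω
    rw [← isingWeight_eq_gksWeight, isingWeight, isingWeight, isingHamiltonian_plus_frozen G h12 β h ω hω,
      Real.exp_add, mul_comm]
  have hobs : ∀ ω : SpinConfig ↥Λ₂, (∀ z : ↥Λ₂, (z : V) ∉ Λ₁ → ω z = 1) →
      spinProduct (inVol Λ₂ A) ω = spinProduct A (glue Λ₁ (ω ∘ volIncl h12) .plus) := by
    intro ω hω
    rw [← spinProduct_glue_of_subset hA ω .plus, glue_plus_frozen_eq h12 ω hω]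
  -- the `+` state of `Λ₁` as the frozen `+` state of `Λ₂`
  have hfrozen : isingCorr G Λ₁ β h .plus A =
      (∑ ω ∈ univ.filter (fun ω : SpinConfig ↥Λ₂ => ∀ x ∈ D, ω x = 1),
          spinProduct (inVol Λ₂ A) ω *
            gksWeight (isingIdx G Λ₂) (gksCoupling G Λ₂ β h .plus) (isingSupp Λ₂) ω) /
        ∑ ω ∈ univ.filter (fun ω : SpinConfig ↥Λ₂ => ∀ x ∈ D, ω x = 1),
          gksWeight (isingIdx G Λ₂) (gksCoupling G Λ₂ β h .plus) (isingSupp Λ₂) ω := by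
    have hnum : ∑ ω ∈ univ.filter (fun ω : SpinConfig ↥Λ₂ => ∀ x ∈ D, ω x = 1),
        spinProduct (inVol Λ₂ A) ω *
          gksWeight (isingIdx G Λ₂) (gksCoupling G Λ₂ β h .plus) (isingSupp Λ₂) ω =
        κ * ∑ a : SpinConfig ↥Λ₁, isingWeight G Λ₁ β h .plus a * spinProduct A (glue Λ₁ a .plus) := by
      rw [Finset.mul_sum, ← sum_filter_comp_eq (1 : ℤˣ) (volIncl h12) (volIncl_injective h12)
        (fun a => κ * (isingWeight G Λ₁ β h .plus a * spinProduct A (glue Λ₁ a .plus))), ← hfilt]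
      refine Finset.sum_congr rfl fun ω hω => ?_
      rw [hw ω (hmem ω hω), hobs ω (hmem ω hω)]
      ring
    have hden : ∑ ω ∈ univ.filter (fun ω : SpinConfig ↥Λ₂ => ∀ x ∈ D, ω x = 1),
        gksWeight (isingIdx G Λ₂) (gksCoupling G Λ₂ β h .plus) (isingSupp Λ₂) ω =
        κ * ∑ a : SpinConfig ↥Λ₁, isingWeight G Λ₁ β h .plus a := by
      rw [Finset.mul_sum, ← sum_filter_comp_eq (1 : ℤˣ) (volIncl h12) (volIncl_injective h12)
        (fun a => κ * isingWeight G Λ₁ β h .plus a), ← hfilt]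
      refine Finset.sum_congr rfl fun ω hω => ?_
      rw [hw ω (hmem ω hω)]
    rw [hnum, hden, mul_div_mul_left _ _ hκpos.ne', isingCorr, isingExpect,
      integral_isingMeasure G Λ₁ β h .plus (measurable_spinProduct A), isingPartitionFunction]
  rw [hfrozen, isingCorr_eq_gksExpect G Λ₂ β h .plus hA]
  exact gksExpect_le_frozen _ _ _ (gksCoupling_nonneg G hβ hh (Or.inr rfl)) D _

/-- **Volume antitonicity of `+` correlations for every set of sites** (Friedli–Velenik 2017,
Exercise 3.12, p. 112 / Lemma 3.22, p. 111; `β, h ≥ 0`, `Λ₁ ⊆ Λ₂`): `⟨σ_A⟩⁺_{Λ₂;β,h} ≤ ⟨σ_A⟩⁺_{Λ₁;β,h}`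
— the spins of `A ∖ Λ₂` are `+1` on both sides (`isingCorr_plus_eq_filter`). [cite: FriedliVelenik2017, Exercise 3.12, p. 112] -/
theorem isingCorr_plus_anti_volume {Λ₁ Λ₂ : Finset V} {β h : ℝ} (hβ : 0 ≤ β) (hh : 0 ≤ h)
    (h12 : Λ₁ ⊆ Λ₂) (A : Finset V) :
    isingCorr G Λ₂ β h .plus A ≤ isingCorr G Λ₁ β h .plus A := by
  have h1 : (A.filter (· ∈ Λ₂)).filter (· ∈ Λ₁) = A.filter (· ∈ Λ₁) := by
    rw [Finset.filter_filter]
    exact Finset.filter_congr fun x _ => ⟨fun h => h.2, fun h => ⟨h12 h, h⟩⟩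
  rw [isingCorr_plus_eq_filter G Λ₂ β h A, isingCorr_plus_eq_filter G Λ₁ β h A, ← h1,
    ← isingCorr_plus_eq_filter G Λ₁ β h (A.filter (· ∈ Λ₂))]
  exact isingCorr_plus_le_of_subset_right G hβ hh (fun x hx => (Finset.mem_filter.1 hx).2) h12

/-- **Volume antitonicity of `+` expectations of spin monomials** (repetitions allowed):
`⟨∏ᵢ σ_{yᵢ}⟩⁺_{Λ₂;β,h} ≤ ⟨∏ᵢ σ_{yᵢ}⟩⁺_{Λ₁;β,h}` for `Λ₁ ⊆ Λ₂`, `β, h ≥ 0` (Friedli–Velenik 2017,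
Exercise 3.12, p. 112; `∏ᵢ σ_{yᵢ}` is a spin product). [cite: FriedliVelenik2017, Exercise 3.12, p. 112] -/
theorem isingExpect_plus_spinMonomial_anti_volume {Λ₁ Λ₂ : Finset V} {β h : ℝ} (hβ : 0 ≤ β)
    (hh : 0 ≤ h) (h12 : Λ₁ ⊆ Λ₂) {n : ℕ} (y : Fin n → V) :
    isingExpect G Λ₂ β h .plus (spinMonomial y) ≤ isingExpect G Λ₁ β h .plus (spinMonomial y) := by
  obtain ⟨A, -, hA⟩ := exists_subset_image_spinMonomial_eq_spinProduct y
  rw [hA]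
  exact isingCorr_plus_anti_volume G hβ hh h12 A

end General

/-! ### Domain monotonicity and bulk bounds for arbitrary sites -/

section Zd

variable {d : ℕ}

/-- **Antitonicity of the `+` domain correlations in the domain, for all sites** (Friedli–Velenik
2017, Exercise 3.12, p. 112, in the limit): for `β ≥ 0`, `Ω ↦ ⟨∏ᵢ σ_{yᵢ}⟩⁺_{Ω_δ;β,0}` is antitone
(`Ω ⊆ Ω'` gives `⟨∏ᵢ σ_{yᵢ}⟩⁺_{Ω'_δ} ≤ ⟨∏ᵢ σ_{yᵢ}⟩⁺_{Ω_δ}`; sites outside the regions carry `+1`). [cite: FriedliVelenik2017, Exercise 3.12, p. 112] -/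
theorem plusDomainCorr_antitone_set {β : ℝ} (hβ : 0 ≤ β) (δ : ℝ) {n : ℕ} (y : Fin n → Site d) :
    Antitone fun Ω : Set (EuclideanSpace ℝ (Fin d)) => plusDomainCorr d Ω δ β n y := by
  intro Ω Ω' hΩ
  refine le_of_tendsto_of_tendsto (tendsto_isingExpect_domainBox hβ Ω' δ y)
    (tendsto_isingExpect_domainBox hβ Ω δ y) (Eventually.of_forall fun L => ?_)
  exact isingExpect_plus_spinMonomial_anti_volume (zdGraph d) hβ le_rfl (domainBox_mono_set hΩ δ L) y

/-- **The bulk `+` state lies below every `+` domain state, at all sites** (Friedli–Velenik 2017,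
Exercise 3.12, p. 112, with Thm. 3.17, in the limit; `Ω_δ ∩ B(L) ⊆ B(L)`): for `β ≥ 0`,
`⟨∏ᵢ σ_{yᵢ}⟩⁺_{β,0} ≤ ⟨∏ᵢ σ_{yᵢ}⟩⁺_{Ω_δ;β,0}`. [cite: FriedliVelenik2017, Exercise 3.12, p. 112] -/
theorem plusExpect_le_plusDomainCorr {β : ℝ} (hβ : 0 ≤ β) (Ω : Set (EuclideanSpace ℝ (Fin d)))
    (δ : ℝ) {n : ℕ} (y : Fin n → Site d) :
    plusExpect d β 0 (spinMonomial y) ≤ plusDomainCorr d Ω δ β n y := by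
  have h := plusDomainCorr_antitone_set hβ δ y (Set.subset_univ Ω)
  simpa only [plusDomainCorr_univ] using h

/-- **The critical bulk correlators lie below every `+` domain state at `β_c`, at all sites**:
`criticalCorr d n y ≤ ⟨∏ᵢ σ_{yᵢ}⟩⁺_{Ω_δ;β_c,0}` (`β_c ≥ 0`). [cite: FriedliVelenik2017, Exercise 3.12, p. 112] -/
theorem criticalCorr_le_plusDomainCorr_apply (Ω : Set (EuclideanSpace ℝ (Fin d))) (δ : ℝ) {n : ℕ}
    (y : Fin n → Site d) : criticalCorr d n y ≤ plusDomainCorr d Ω δ (criticalBeta d) n y :=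
  plusExpect_le_plusDomainCorr (criticalBeta_nonneg d) Ω δ y

/-! ### Covariance under lattice translations -/

/-- `meshPos δ` is additive in the site: `δ(z + w) = δz + δw`. [folklore] -/
theorem meshPos_add (δ : ℝ) (z w : Site d) : meshPos δ (z + w) = meshPos δ z + meshPos δ w := by
  ext i
  simp [mul_add]

/-- `δ(z - w) = δz - δw`. [folklore] -/
theorem meshPos_sub (δ : ℝ) (z w : Site d) : meshPos δ (z - w) = meshPos δ z - meshPos δ w := by
  ext i
  simp [mul_sub]

/-- Membership in the discretisation of a translated domain: `δz ∈ δw + Ω ↔ δ(z - w) ∈ Ω`. [folklore] -/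
theorem meshPos_mem_vadd_iff (Ω : Set (EuclideanSpace ℝ (Fin d))) (δ : ℝ) (w z : Site d) :
    meshPos δ z ∈ meshPos δ w +ᵥ Ω ↔ meshPos δ (z - w) ∈ Ω := by
  rw [Set.mem_vadd_set_iff_neg_vadd_mem, vadd_eq_add, meshPos_sub, neg_add_eq_sub]

/-- The sandwich of cut-off regions, inner half: `(Ω_δ ∩ B(L)) + w ⊆ (δw + Ω)_δ ∩ B(L + ‖w‖_∞)`. [folklore] -/
theorem map_shift_domainBox_subset (Ω : Set (EuclideanSpace ℝ (Fin d))) (δ : ℝ) (w : Site d) (L : ℕ) :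
    (domainBox Ω δ L).map (Site.shift w).toEmbedding ⊆
      domainBox (meshPos δ w +ᵥ Ω) δ (L + Site.supNorm w) := by
  intro z hz
  rw [mem_map_shift_iff', mem_domainBox] at hz
  rw [mem_domainBox, meshPos_mem_vadd_iff]
  exact ⟨map_shift_box_subset L w ((mem_map_shift_iff' _ _ _).2 hz.1), hz.2⟩

/-- The sandwich of cut-off regions, outer half: `(δw + Ω)_δ ∩ B(L) ⊆ (Ω_δ ∩ B(L + ‖w‖_∞)) + w`. [folklore] -/
theorem domainBox_vadd_subset_map_shift (Ω : Set (EuclideanSpace ℝ (Fin d))) (δ : ℝ) (w : Site d)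
    (L : ℕ) :
    domainBox (meshPos δ w +ᵥ Ω) δ L ⊆
      (domainBox Ω δ (L + Site.supNorm w)).map (Site.shift w).toEmbedding := by
  intro z hz
  rw [mem_domainBox, meshPos_mem_vadd_iff] at hz
  rw [mem_map_shift_iff', mem_domainBox]
  exact ⟨(mem_map_shift_iff' _ _ _).1 (box_subset_map_shift_box L w hz.1), hz.2⟩

/-- **Finite-volume translation covariance on spin monomials**:
`⟨∏ᵢ σ_{yᵢ + w}⟩⁺_{Λ + w;β,h} = ⟨∏ᵢ σ_{yᵢ}⟩⁺_{Λ;β,h}` (Friedli–Velenik 2017, proof of Thm. 3.17,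
p. 113; the tree's `isingExpect_plus_shift`). [cite: FriedliVelenik2017, Thm. 3.17 (proof), p. 113] -/
theorem isingExpect_plus_map_shift_spinMonomial (Λ : Finset (Site d)) (w : Site d) (β h : ℝ) {n : ℕ}
    (y : Fin n → Site d) :
    isingExpect (zdGraph d) (Λ.map (Site.shift w).toEmbedding) β h .plus
        (spinMonomial fun i => y i + w) =
      isingExpect (zdGraph d) Λ β h .plus (spinMonomial y) := by
  rw [isingExpect_plus_shift Λ w β h (measurable_spinMonomial _)]
  congr 1
  funext σ
  simp [spinMonomial, spinAt, configShift_apply]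

/-- **Covariance of the `+` domain correlations under lattice translations** (Friedli–Velenik 2017,
Thm. 3.17 (2) and its proof, p. 113: `⟨f ∘ θ_w⟩⁺_{Λ + w} = ⟨f⟩⁺_Λ`, and independence of the limit from
the exhausting sequence): for `β ≥ 0`, `w ∈ ℤ^d` and all sites `y`,
`⟨∏ᵢ σ_{yᵢ + w}⟩⁺_{(δw + Ω)_δ;β,0} = ⟨∏ᵢ σ_{yᵢ}⟩⁺_{Ω_δ;β,0}`. The cut-off regions of `δw + Ω`, seen
from `w`, are sandwiched between those of `Ω` at `L ∓ ‖w‖_∞`, and volume antitonicity squeezes (as in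
`plusCorr_shift`). [cite: FriedliVelenik2017, Thm. 3.17, p. 106] -/
theorem plusDomainCorr_vadd {β : ℝ} (hβ : 0 ≤ β) (Ω : Set (EuclideanSpace ℝ (Fin d))) (δ : ℝ)
    (w : Site d) {n : ℕ} (y : Fin n → Site d) :
    plusDomainCorr d (meshPos δ w +ᵥ Ω) δ β n (fun i => y i + w) = plusDomainCorr d Ω δ β n y := by
  set Ω' : Set (EuclideanSpace ℝ (Fin d)) := meshPos δ w +ᵥ Ω with hΩ'
  set M := Site.supNorm w with hM
  have hmain := tendsto_isingExpect_domainBox hβ Ω' δ (fun i => y i + w)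
  have hlow : Tendsto (fun L : ℕ => isingExpect (zdGraph d)
      ((domainBox Ω δ (L + M)).map (Site.shift w).toEmbedding) β 0 .plus
      (spinMonomial fun i => y i + w)) atTop (𝓝 (plusDomainCorr d Ω δ β n y)) := by
    simp only [isingExpect_plus_map_shift_spinMonomial]
    exact (Filter.tendsto_add_atTop_iff_nat M).2 (tendsto_isingExpect_domainBox hβ Ω δ y)
  have hup : Tendsto (fun L : ℕ => isingExpect (zdGraph d)
      ((domainBox Ω δ (L - M)).map (Site.shift w).toEmbedding) β 0 .plus
      (spinMonomial fun i => y i + w)) atTop (𝓝 (plusDomainCorr d Ω δ β n y)) := by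
    simp only [isingExpect_plus_map_shift_spinMonomial]
    exact (tendsto_isingExpect_domainBox hβ Ω δ y).comp (tendsto_sub_atTop_nat M)
  refine tendsto_nhds_unique hmain (hlow.squeeze' hup (Eventually.of_forall fun L => ?_) ?_)
  · -- `Ω'_δ ∩ B(L) ⊆ (Ω_δ ∩ B(L + M)) + w`
    exact isingExpect_plus_spinMonomial_anti_volume (zdGraph d) hβ le_rfl
      (domainBox_vadd_subset_map_shift Ω δ w L) _
  · -- `(Ω_δ ∩ B(L - M)) + w ⊆ Ω'_δ ∩ B(L)` for `L ≥ M`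
    filter_upwards [eventually_ge_atTop M] with L hL
    have h2 := map_shift_domainBox_subset Ω δ w (L - M)
    rw [Nat.sub_add_cancel hL] at h2
    exact isingExpect_plus_spinMonomial_anti_volume (zdGraph d) hβ le_rfl h2 _

/-- **Translation covariance, evaluated at arbitrary sites**: `⟨∏ᵢ σ_{yᵢ}⟩⁺_{(δw + Ω)_δ;β,0} =
⟨∏ᵢ σ_{yᵢ - w}⟩⁺_{Ω_δ;β,0}` (Friedli–Velenik 2017, Thm. 3.17 (2)). [cite: FriedliVelenik2017, Thm. 3.17, p. 106] -/
theorem plusDomainCorr_vadd_apply {β : ℝ} (hβ : 0 ≤ β) (Ω : Set (EuclideanSpace ℝ (Fin d))) (δ : ℝ)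
    (w : Site d) {n : ℕ} (y : Fin n → Site d) :
    plusDomainCorr d (meshPos δ w +ᵥ Ω) δ β n y = plusDomainCorr d Ω δ β n (fun i => y i - w) := by
  simpa only [sub_add_cancel] using plusDomainCorr_vadd hβ Ω δ w (fun i => y i - w)

end Zd

end Literature.Probability.LatticeModels
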